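import Mathlib
import HarnessLib

/-!
# One-perturbation variational principles (Borwein–Zhu 2005, §6.5.1)

[cite: BorweinZhu2005, §6.5.1 Theorems 6.5.1, 6.5.2 (pp. 281–284); §6.5.4 Exercise 6.5.2
(pp. 288–290)]

J. M. Borwein, Q. J. Zhu, *Techniques of Variational Analysis*, CMS Books in Mathematics,
Springer 2005, Section 6.5 "One-Perturbation Variational Principles", §6.5.1.

In a typical variational principle (Ekeland, Borwein–Preiss, Deville–Godefroy–Zizler, Stegall)
one fixes a lsc function `f` bounded below and looks for *some* small perturbation `g` such that
`f + g` attains its minimum.  Section 6.5 reverses the scheme: one looks for a *single*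
perturbation `φ` such that `f + φ` attains its minimum for *every* `f` of a large class.

* `IsOnePerturbation φ` : for every bounded continuous `f : X → ℝ` the function `f + φ` attains
  its minimum on `X` (the hypothesis of Theorem 6.5.2).
* `exists_forall_le_of_isCompact_sublevel`, `exists_mapClusterPt_of_minimizing`,
  `minimizer_of_mapClusterPt`, `exists_tendsto_subseq_of_minimizing` : the Weierstrass remark
  preceding Theorem 6.5.1 — a lsc function with a nonempty compact sublevel set attains its
  minimum, and the minimisation problem is well posed (every minimising net/sequence clusters,
  and only at minimisers).
* `exists_forall_add_le` : **Theorem 6.5.1** (one-perturbation variational principle) — if `φ`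
  is lsc with compact sublevel sets and `f` is lsc and bounded below then `f + φ` attains its
  minimum; `isOnePerturbation_of_isCompact_sublevel`, `isOnePerturbation_of_compactSpace`
  (the "dom φ relatively compact" clause) and the Tykhonov example
  `exists_forall_add_mul_dist_sq_le` (`φ = c·dist(·, x̄)²` on a proper space, §6.5.4).
* `IsOnePerturbation.lowerSemicontinuous`, `IsOnePerturbation.isCompact_sublevel`,
  `IsOnePerturbation.bddBelow` : **Theorem 6.5.2** — on a metric space the conditions of
  Theorem 6.5.1 are also necessary; `isOnePerturbation_iff` combines 6.5.1 and 6.5.2.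
* `exists_localized_minimizer` : **Exercise 6.5.2** — in a normed space, rescaling and
  translating the argument of `φ` localises the minimiser: for `λ > 0` there is `μ > 0` such
  that `f + φ(μ⁻¹(· - x̄))` has a minimiser `u` with `‖u - x̄‖ ≤ λ`.

DEVIATIONS (declared).  (1) `f` and `φ` are real-valued (`X → ℝ`); the book allows proper lsc
`X → ℝ ∪ {+∞}`.  For real-valued `φ` the clause "dom φ relatively compact" of Theorem 6.5.1
means that `X` is compact and is rendered as `isOnePerturbation_of_compactSpace`.
(2) Theorem 6.5.2, lower semicontinuity: the printed `r₀ = inf R` (limits of `φ` along sequences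
`xᵢ → x₀`) is replaced by the equal quantity `r₀ = liminf_{x → x₀} φ x` (`Filter.liminf φ (𝓝 x₀)`),
and the Urysohn functions `hᵢ` are the explicit `min (1, dist(x, x₀)/δᵢ)` with radii
`δᵢ ≤ 2⁻ⁱ`; the printed `f = α h₀ + ∑_{i ≥ 1} 2⁻ⁱ hᵢ` and inequality (6.5.1) are kept.
(3) Theorem 6.5.2, compactness: instead of a paracompact refinement and Dugundji's extension
theorem we extract an explicitly separated subsequence `(v_j)` of a sequence without cluster
points, choose pairwise disjoint, locally finite balls `B(v_j, ρ_j)` with `ρ_j ≤ 1/(j+1)` on which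
(6.5.2) holds, and sum the tent functions `-c_j (1 - dist(x, v_j)/ρ_j)₊` over all of `X`
(`finsum`, continuous by local finiteness); we do not normalise `inf φ = 0`, so (6.5.3) reads
`f + φ > inf φ - 1`, and the printed `1/i` (i ≥ 1) is `1/(j+1)` (j ≥ 0).
(4) Well-posedness is stated for an arbitrary filter (nets) through `MapClusterPt`; the
sequential form assumes a first-countable topology.  (5) Exercise 6.5.2 is proved with the
explicit choice `μ = λ / R`, `R` a bound for the compact sublevel set
`{φ ≤ f x̄ - inf f + φ 0}`.  Exercise 6.5.1 (weakly compact sublevel sets) and §§6.5.2–6.5.3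
(perturbation functions on separable Banach spaces, generic differentiability) are not
formalised.

TREE / MATHLIB STATUS.  Mathlib has the extreme-value theorem for lsc functions on compact
sets (`LowerSemicontinuousOn.exists_isMinOn`, used below) and for coercive *continuous*
functions (`Continuous.exists_forall_le'`); the tree has Ekeland / Borwein–Preiss /
Deville–Godefroy–Zizler variational principles (`Literature.Analysis.Convex.`
`EkelandVariationalPrinciple` / `BorweinPreissVariationalPrinciple` /
`DevilleGodefroyZizlerVariationalPrinciple`, BZ §§2.1, 2.5), and the folklore "continuous
function with compact sublevel sets is bounded below"
(`Literature.Topology.FourManifolds.ThickenSurfaceTwist.exists_min_of_isCompact_preimage`);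
none of these is imported or restated here (different statements).  Imports: `Mathlib`,
`HarnessLib` only.
-/

open Filter Topology Set Metric

namespace Literature.Analysis.Convex.OnePerturbationVariationalPrinciple

/-! ## The Weierstrass remark and Theorem 6.5.1 (Hausdorff topological spaces) -/

section Topological

variable {X : Type*} [TopologicalSpace X]

/-- [cite: BorweinZhu2005, §6.5.1, hypothesis of Theorem 6.5.2, p. 281] `φ` is a
*one-perturbation function*: for every bounded continuous `f : X → ℝ` the perturbed function
`f + φ` attains its minimum on `X`. -/
def IsOnePerturbation (φ : X → ℝ) : Prop :=
  ∀ f : X → ℝ, Continuous f → (∃ C : ℝ, ∀ x, |f x| ≤ C) →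
    ∃ a, ∀ y, f a + φ a ≤ f y + φ y

/-- [cite: BorweinZhu2005, §6.5.1, proof of Theorem 6.5.2 ("obviously φ is bounded from
below"), p. 282] A one-perturbation function attains its minimum (take `f = 0`). -/
theorem IsOnePerturbation.exists_forall_le {φ : X → ℝ} (h : IsOnePerturbation φ) :
    ∃ a, ∀ y, φ a ≤ φ y := by
  obtain ⟨a, ha⟩ := h (fun _ => 0) continuous_const ⟨0, fun _ => by simp⟩
  exact ⟨a, fun y => by simpa using ha y⟩

/-- [cite: BorweinZhu2005, §6.5.1 Theorem 6.5.2 (conclusion "bounded from below"), p. 282] -/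
theorem IsOnePerturbation.bddBelow {φ : X → ℝ} (h : IsOnePerturbation φ) :
    BddBelow (range φ) := by
  obtain ⟨a, ha⟩ := h.exists_forall_le
  exact ⟨φ a, by rintro _ ⟨y, rfl⟩; exact ha y⟩

/-- [cite: BorweinZhu2005, §6.5.1, remark before Theorem 6.5.1 (Weierstrass), p. 281]
A lsc function with a nonempty compact sublevel set attains its minimum. -/
theorem exists_forall_le_of_isCompact_sublevel {g : X → ℝ} (hg : LowerSemicontinuous g)
    {r : ℝ} (hne : ∃ x, g x ≤ r) (hc : IsCompact {x | g x ≤ r}) :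
    ∃ a, ∀ y, g a ≤ g y := by
  obtain ⟨x₁, hx₁⟩ := hne
  obtain ⟨a, ha, hmin⟩ :=
    (hg.lowerSemicontinuousOn {x | g x ≤ r}).exists_isMinOn ⟨x₁, hx₁⟩ hc
  refine ⟨a, fun y => ?_⟩
  by_cases hy : g y ≤ r
  · exact isMinOn_iff.mp hmin y hy
  · exact le_trans ha (le_of_lt (not_le.mp hy))

/-- [cite: BorweinZhu2005, §6.5.1, remark before Theorem 6.5.1 (well-posedness), p. 281]
If all sublevel sets of `g` are compact, every minimising net `u` along a filter `l`
(`g (u n) < g y + ε` eventually, for all `y`, `ε > 0`) has a cluster point. -/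
theorem exists_mapClusterPt_of_minimizing {g : X → ℝ}
    (hc : ∀ r, IsCompact {x | g x ≤ r}) {ι : Type*} {l : Filter ι} [NeBot l] {u : ι → X}
    (hu : ∀ y, ∀ ε : ℝ, 0 < ε → ∀ᶠ n in l, g (u n) < g y + ε) :
    ∃ a, MapClusterPt a l u := by
  obtain ⟨n₀⟩ : Nonempty ι := nonempty_of_neBot l
  have hfr : ∃ᶠ n in l, u n ∈ {x | g x ≤ g (u n₀) + 1} :=
    ((hu (u n₀) 1 one_pos).mono fun n hn => le_of_lt hn).frequently
  obtain ⟨a, -, ha⟩ := (hc (g (u n₀) + 1)).exists_mapClusterPt_of_frequently hfr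
  exact ⟨a, ha⟩

/-- [cite: BorweinZhu2005, §6.5.1, remark before Theorem 6.5.1 (well-posedness), p. 281]
Every cluster point of a minimising net of a lsc function is a minimiser. -/
theorem minimizer_of_mapClusterPt {g : X → ℝ} (hg : LowerSemicontinuous g)
    {ι : Type*} {l : Filter ι} {u : ι → X}
    (hu : ∀ y, ∀ ε : ℝ, 0 < ε → ∀ᶠ n in l, g (u n) < g y + ε)
    {a : X} (ha : MapClusterPt a l u) : ∀ y, g a ≤ g y := by
  intro y
  by_contra hlt
  have hlt' : g y < g a := not_le.mp hlt
  obtain ⟨t, hyt, hta⟩ := exists_between hlt'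
  have hnhds : {x | t < g x} ∈ 𝓝 a := (lowerSemicontinuousAt_iff.mp (hg a)) t hta
  have hfreq : ∃ᶠ n in l, u n ∈ {x | t < g x} := (mapClusterPt_iff_frequently.mp ha) _ hnhds
  have hev : ∀ᶠ n in l, g (u n) < t := by
    have := hu y (t - g y) (by linarith)
    exact this.mono fun n hn => by linarith
  obtain ⟨n, hn1, hn2⟩ := (hfreq.and_eventually hev).exists
  exact absurd hn1 (not_lt.mpr (le_of_lt hn2))

/-- [cite: BorweinZhu2005, §6.5.1, remark before Theorem 6.5.1 ("subsequence, in the metric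
case"), p. 281] Sequential well-posedness: in a first-countable space every minimising
sequence has a subsequence converging to a minimiser. -/
theorem exists_tendsto_subseq_of_minimizing [FirstCountableTopology X] {g : X → ℝ}
    (hg : LowerSemicontinuous g) (hc : ∀ r, IsCompact {x | g x ≤ r}) {u : ℕ → X}
    (hu : ∀ y, ∀ ε : ℝ, 0 < ε → ∀ᶠ n in atTop, g (u n) < g y + ε) :
    ∃ a, (∀ y, g a ≤ g y) ∧ ∃ ψ : ℕ → ℕ, StrictMono ψ ∧ Tendsto (u ∘ ψ) atTop (𝓝 a) := by
  obtain ⟨a, ha⟩ := exists_mapClusterPt_of_minimizing hc hu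
  obtain ⟨ψ, hψ, hlim⟩ := ha.tendsto_subseq
  exact ⟨a, minimizer_of_mapClusterPt hg hu ha, ψ, hψ, hlim⟩

/-- [cite: BorweinZhu2005, §6.5.1 Theorem 6.5.1 (proof:
`(f+φ)⁻¹(-∞,r] ⊆ φ⁻¹(-∞, r - inf f]`), p. 281] Sublevel sets of `f + φ` are compact. -/
theorem isCompact_sublevel_add {φ f : X → ℝ} (hφ : LowerSemicontinuous φ)
    (hφc : ∀ r, IsCompact {x | φ x ≤ r}) (hf : LowerSemicontinuous f) {m : ℝ}
    (hm : ∀ x, m ≤ f x) (r : ℝ) : IsCompact {x | f x + φ x ≤ r} :=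
  (hφc (r - m)).of_isClosed_subset ((hf.add hφ).isClosed_preimage r) fun x hx => by
    simp only [mem_setOf_eq] at hx ⊢
    linarith [hm x]

/-- [cite: BorweinZhu2005, §6.5.1 Theorem 6.5.1 (One-Perturbation Variational Principle),
p. 281] If `φ` is lsc with compact sublevel sets and `f` is lsc and bounded below on a
nonempty topological space, then `f + φ` attains its minimum. -/
theorem exists_forall_add_le [Nonempty X] {φ f : X → ℝ} (hφ : LowerSemicontinuous φ)
    (hφc : ∀ r, IsCompact {x | φ x ≤ r}) (hf : LowerSemicontinuous f)
    (hfb : ∃ m, ∀ x, m ≤ f x) : ∃ a, ∀ y, f a + φ a ≤ f y + φ y := by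
  obtain ⟨m, hm⟩ := hfb
  obtain ⟨x₁⟩ := ‹Nonempty X›
  exact exists_forall_le_of_isCompact_sublevel (hf.add hφ) ⟨x₁, le_rfl⟩
    (isCompact_sublevel_add hφ hφc hf hm _)

/-- [cite: BorweinZhu2005, §6.5.1 Theorem 6.5.1 (well-posed form, remark before the theorem),
p. 281] Under the hypotheses of Theorem 6.5.1 the problem `min (f + φ)` is well posed:
minimising nets cluster, and every cluster point is a minimiser. -/
theorem wellPosed_add {φ f : X → ℝ} (hφ : LowerSemicontinuous φ)
    (hφc : ∀ r, IsCompact {x | φ x ≤ r}) (hf : LowerSemicontinuous f) (hfb : ∃ m, ∀ x, m ≤ f x)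
    {ι : Type*} {l : Filter ι} [NeBot l] {u : ι → X}
    (hu : ∀ y, ∀ ε : ℝ, 0 < ε → ∀ᶠ n in l, f (u n) + φ (u n) < f y + φ y + ε) :
    (∃ a, MapClusterPt a l u) ∧
      ∀ a, MapClusterPt a l u → ∀ y, f a + φ a ≤ f y + φ y := by
  obtain ⟨m, hm⟩ := hfb
  exact ⟨exists_mapClusterPt_of_minimizing (isCompact_sublevel_add hφ hφc hf hm) hu,
    fun a ha => minimizer_of_mapClusterPt (hf.add hφ) hu ha⟩

/-- [cite: BorweinZhu2005, §6.5.1 Theorem 6.5.1 ⇒ hypothesis of Theorem 6.5.2, p. 281]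
A lsc function with compact sublevel sets is a one-perturbation function. -/
theorem isOnePerturbation_of_isCompact_sublevel [Nonempty X] {φ : X → ℝ}
    (hφ : LowerSemicontinuous φ) (hφc : ∀ r, IsCompact {x | φ x ≤ r}) :
    IsOnePerturbation φ := fun _ hf ⟨C, hC⟩ =>
  exists_forall_add_le hφ hφc hf.lowerSemicontinuous ⟨-C, fun x => (abs_le.mp (hC x)).1⟩

/-- [cite: BorweinZhu2005, §6.5.1 Theorem 6.5.1 ("in particular, if dom φ is relatively
compact"), p. 281] On a nonempty compact space every lsc `φ` is a one-perturbation function. -/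
theorem isOnePerturbation_of_compactSpace [CompactSpace X] [Nonempty X] {φ : X → ℝ}
    (hφ : LowerSemicontinuous φ) : IsOnePerturbation φ :=
  isOnePerturbation_of_isCompact_sublevel hφ fun r => (hφ.isClosed_preimage r).isCompact

end Topological

/-! ## Tykhonov regularisation (§6.5.4): `φ = c · dist(·, x̄)²` on a proper space -/

section Proper

variable {X : Type*} [PseudoMetricSpace X] [ProperSpace X]

/-- [cite: BorweinZhu2005, §6.5.4 Commentary (Tykhonov regularization, `φ` = square of the
norm), p. 288] On a proper (pseudo)metric space the sublevel sets of `c · dist(·, x̄)²`,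
`c > 0`, are compact. -/
theorem isCompact_sublevel_mul_dist_sq (xbar : X) {c : ℝ} (hc : 0 < c) (r : ℝ) :
    IsCompact {x | c * dist x xbar ^ 2 ≤ r} := by
  refine (isCompact_closedBall xbar (max 1 (r / c))).of_isClosed_subset
    (isClosed_le (by fun_prop) continuous_const) fun x hx => ?_
  simp only [mem_setOf_eq] at hx
  rw [mem_closedBall]
  by_cases hd : dist x xbar ≤ 1
  · exact hd.trans (le_max_left _ _)
  · have hd' : 1 < dist x xbar := not_le.mp hd
    have h1 : dist x xbar ≤ dist x xbar ^ 2 := by nlinarith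
    have h2 : dist x xbar ^ 2 ≤ r / c := by
      rw [le_div_iff₀ hc]; linarith
    exact (h1.trans h2).trans (le_max_right _ _)

/-- [cite: BorweinZhu2005, §6.5.4 Commentary (Tykhonov [252]: `f + ‖·‖²` always attains its
minimum) with Theorem 6.5.1, pp. 281, 288] Tykhonov regularisation on a proper space: a lsc
function bounded below plus `c · dist(·, x̄)²` attains its minimum. -/
theorem exists_forall_add_mul_dist_sq_le [Nonempty X] {f : X → ℝ} (hf : LowerSemicontinuous f)
    (hfb : ∃ m, ∀ x, m ≤ f x) (xbar : X) {c : ℝ} (hc : 0 < c) :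
    ∃ a, ∀ y, f a + c * dist a xbar ^ 2 ≤ f y + c * dist y xbar ^ 2 :=
  exists_forall_add_le (Continuous.lowerSemicontinuous (by fun_prop))
    (isCompact_sublevel_mul_dist_sq xbar hc) hf hfb

end Proper

/-! ## Theorem 6.5.2: the converse on metric spaces -/

section Converse

variable {X : Type*} [MetricSpace X] {φ : X → ℝ}

/-- [cite: BorweinZhu2005, §6.5.1 Theorem 6.5.2 (first part: "φ is a lsc function"), proof
pp. 282–283 with inequality (6.5.1)] A one-perturbation function on a metric space is lower
semicontinuous. -/
theorem IsOnePerturbation.lowerSemicontinuous (h : IsOnePerturbation φ) :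
    LowerSemicontinuous φ := by
  obtain ⟨a₀, ha₀⟩ := h.exists_forall_le
  intro x₀
  by_contra hnot
  -- `r₀ := liminf_{x → x₀} φ`, well defined since `φ ≥ φ a₀`
  have hbdd : IsBoundedUnder (· ≥ ·) (𝓝 x₀) φ :=
    ⟨φ a₀, eventually_map.mpr (Eventually.of_forall fun y => ha₀ y)⟩
  have hcob : IsCoboundedUnder (· ≥ ·) (𝓝 x₀) φ :=
    ⟨φ x₀, fun b hb => (show ∀ᶠ y in 𝓝 x₀, b ≤ φ y from hb).self_of_nhds⟩
  set r₀ : ℝ := liminf φ (𝓝 x₀) with hr₀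
  -- (a) `r₀ < φ x₀` because `φ` is not lsc at `x₀`
  have h1 : r₀ < φ x₀ := by
    have hex : ∃ y, y < φ x₀ ∧ ¬∀ᶠ x' in 𝓝 x₀, y < φ x' := by
      by_contra hcon
      exact hnot (lowerSemicontinuousAt_iff.mpr fun y hy =>
        Classical.by_contradiction fun hne => hcon ⟨y, hy, hne⟩)
    obtain ⟨y, hy, hfr⟩ := hex
    have hfreq : ∃ᶠ x' in 𝓝 x₀, φ x' ≤ y :=
      (not_eventually.mp hfr).mono fun x hx => not_lt.mp hx
    exact (liminf_le_of_frequently_le hfreq hbdd).trans_lt hy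
  -- (b) `φ > r₀ - ε` near `x₀`; (c) `φ < r₀ + ε` frequently near `x₀`
  have h2 : ∀ ε : ℝ, 0 < ε → ∀ᶠ x in 𝓝 x₀, r₀ - ε < φ x := fun ε hε =>
    eventually_lt_of_lt_liminf (by linarith) hbdd
  have h3 : ∀ ε : ℝ, 0 < ε → ∃ᶠ x in 𝓝 x₀, φ x < r₀ + ε := fun ε hε =>
    frequently_lt_of_liminf_lt hcob (by linarith)
  have h4 : φ a₀ ≤ r₀ := by
    by_contra hlt
    obtain ⟨x, hx⟩ := (h3 (φ a₀ - r₀) (by linarith [not_le.mp hlt])).exists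
    linarith [ha₀ x]
  -- neighbourhoods `Vᵢ = B(x₀, δᵢ)` with `φ > r₀ - 2^{-(i+1)}` on `Vᵢ` and `δᵢ ≤ 2^{-i}`
  have hδ : ∀ i : ℕ, ∃ δ : ℝ, 0 < δ ∧ δ ≤ (1 / 2 : ℝ) ^ i ∧
      ∀ x, dist x x₀ < δ → r₀ - (1 / 2 : ℝ) ^ (i + 1) < φ x := by
    intro i
    obtain ⟨δ, hδ, hball⟩ :=
      Metric.eventually_nhds_iff.mp (h2 ((1 / 2 : ℝ) ^ (i + 1)) (by positivity))
    exact ⟨min δ ((1 / 2 : ℝ) ^ i), lt_min hδ (by positivity), min_le_right _ _,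
      fun x hx => hball (lt_of_lt_of_le hx (min_le_left _ _))⟩
  choose δ hδpos hδle hδφ using hδ
  -- Urysohn functions `hᵢ : X → [0,1]`, `hᵢ = 1` off `Vᵢ`, `hᵢ x₀ = 0`
  set hb : ℕ → X → ℝ := fun i x => min 1 (dist x x₀ / δ i) with hb_def
  have hb_nn : ∀ i x, 0 ≤ hb i x := fun i x =>
    le_min zero_le_one (div_nonneg dist_nonneg (hδpos i).le)
  have hb_le : ∀ i x, hb i x ≤ 1 := fun i x => min_le_left _ _
  have hb_cont : ∀ i, Continuous (hb i) := fun i =>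
    continuous_const.min ((continuous_id.dist continuous_const).div_const _)
  have hb_zero : ∀ i, hb i x₀ = 0 := fun i => by simp [hb_def]
  have hb_one : ∀ i x, δ i ≤ dist x x₀ → hb i x = 1 := fun i x hx =>
    min_eq_left ((one_le_div (hδpos i)).mpr hx)
  -- `f := α h₀ + ∑_{i ≥ 1} 2^{-i} hᵢ` with `α > r₀ - inf φ`
  set α : ℝ := r₀ - φ a₀ + 1 with hα
  have hα_pos : 0 < α := by linarith
  have hgeom : Summable fun i : ℕ => (1 / 2 : ℝ) ^ (i + 1) :=
    (summable_nat_add_iff 1).mpr summable_geometric_two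
  have hterm_nn : ∀ x i, 0 ≤ (1 / 2 : ℝ) ^ (i + 1) * hb (i + 1) x := fun x i =>
    mul_nonneg (by positivity) (hb_nn _ _)
  have hterm_le : ∀ x i, (1 / 2 : ℝ) ^ (i + 1) * hb (i + 1) x ≤ (1 / 2 : ℝ) ^ (i + 1) :=
    fun x i => mul_le_of_le_one_right (by positivity) (hb_le _ _)
  have hsum : ∀ x, Summable fun i => (1 / 2 : ℝ) ^ (i + 1) * hb (i + 1) x := fun x =>
    Summable.of_nonneg_of_le (hterm_nn x) (hterm_le x) hgeom
  set T : ℝ := ∑' i : ℕ, (1 / 2 : ℝ) ^ (i + 1) with hT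
  have hT_nn : 0 ≤ T := tsum_nonneg fun i => by positivity
  set F : X → ℝ := fun x => α * hb 0 x + ∑' i, (1 / 2 : ℝ) ^ (i + 1) * hb (i + 1) x with hF
  have hF_cont : Continuous F := by
    refine (continuous_const.mul (hb_cont 0)).add ?_
    refine continuous_tsum (fun i => continuous_const.mul (hb_cont (i + 1))) hgeom ?_
    intro i x
    rw [Real.norm_eq_abs, abs_of_nonneg (hterm_nn x i)]
    exact hterm_le x i
  have hF_nn : ∀ x, 0 ≤ F x := fun x =>
    add_nonneg (mul_nonneg hα_pos.le (hb_nn 0 x)) (tsum_nonneg (hterm_nn x))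
  have hF_le : ∀ x, F x ≤ α + T := fun x =>
    add_le_add (mul_le_of_le_one_right hα_pos.le (hb_le 0 x))
      ((hsum x).tsum_le_tsum (hterm_le x) hgeom)
  have hF_zero : F x₀ = 0 := by simp [hF, hb_zero]
  have hF_ge0 : ∀ x, α * hb 0 x ≤ F x := fun x =>
    le_add_of_nonneg_right (tsum_nonneg (hterm_nn x))
  have hF_gei : ∀ x i, (1 / 2 : ℝ) ^ (i + 1) * hb (i + 1) x ≤ F x := fun x i =>
    ((hsum x).le_tsum i fun j _ => hterm_nn x j).trans
      (le_add_of_nonneg_left (mul_nonneg hα_pos.le (hb_nn 0 x)))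
  -- inequality (6.5.1): `F x + φ x > r₀` for every `x`
  have hkey : ∀ x, r₀ < F x + φ x := by
    intro x
    by_cases hx : x = x₀
    · rw [hx, hF_zero, zero_add]; exact h1
    have hd : 0 < dist x x₀ := dist_pos.mpr hx
    have hex : ∃ i, δ i ≤ dist x x₀ := by
      obtain ⟨i, hi⟩ := exists_pow_lt_of_lt_one hd (by norm_num : (1 / 2 : ℝ) < 1)
      exact ⟨i, (hδle i).trans hi.le⟩
    classical
    obtain ⟨n, hn, hmin⟩ : ∃ n, δ n ≤ dist x x₀ ∧ ∀ k < n, dist x x₀ < δ k :=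
      ⟨Nat.find hex, Nat.find_spec hex, fun k hk => not_le.mp (Nat.find_min hex hk)⟩
    cases n with
    | zero =>
      -- Case 1 of the text: `x ∉ V₀`, so `h₀ x = 1` and `F x + φ x ≥ α + inf φ > r₀`
      have h0 : hb 0 x = 1 := hb_one 0 x hn
      have : α ≤ F x := by simpa [h0] using hF_ge0 x
      linarith [ha₀ x]
    | succ k =>
      -- Case 2: `x ∈ V_k \ V_{k+1}`: `F x ≥ 2^{-(k+1)}` and `φ x > r₀ - 2^{-(k+1)}`
      have h1k : hb (k + 1) x = 1 := hb_one (k + 1) x hn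
      have hFk : (1 / 2 : ℝ) ^ (k + 1) ≤ F x := by simpa [h1k] using hF_gei x k
      have hφk : r₀ - (1 / 2 : ℝ) ^ (k + 1) < φ x := hδφ k x (hmin k (Nat.lt_succ_self k))
      linarith
  -- but `inf (F + φ) ≤ r₀`: the minimum guaranteed by `h` cannot exist
  obtain ⟨a, ha⟩ := h F hF_cont ⟨α + T, fun x =>
    abs_le.mpr ⟨by linarith [hF_nn x, hα_pos.le], hF_le x⟩⟩
  have hεpos : 0 < (F a + φ a - r₀) / 2 := by linarith [hkey a]
  have hFsmall : ∀ᶠ x in 𝓝 x₀, F x < (F a + φ a - r₀) / 2 := by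
    have ht : Tendsto F (𝓝 x₀) (𝓝 (F x₀)) := hF_cont.continuousAt
    rw [hF_zero] at ht
    exact (ht.eventually (Iio_mem_nhds hεpos)).mono fun x hx => hx
  obtain ⟨x, hxφ, hxF⟩ := ((h3 _ hεpos).and_eventually hFsmall).exists
  linarith [ha x]

/-- [cite: BorweinZhu2005, §6.5.1 Theorem 6.5.2 (second part: "whose sublevel sets are all
compact"), proof pp. 283–284 with (6.5.2), (6.5.3)] The sublevel sets of a one-perturbation
function on a metric space are compact. -/
theorem IsOnePerturbation.isCompact_sublevel (h : IsOnePerturbation φ) (r : ℝ) :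
    IsCompact {x | φ x ≤ r} := by
  have hlsc := h.lowerSemicontinuous
  obtain ⟨a₀, ha₀⟩ := h.exists_forall_le
  set m : ℝ := φ a₀ with hm
  have hclosed : IsClosed {x | φ x ≤ r} := hlsc.isClosed_preimage r
  rw [isCompact_iff_isSeqCompact]
  intro u hu
  by_contra hno
  have hrm : m ≤ r := (ha₀ (u 0)).trans (hu 0)
  -- the sequence `u ⊆ X_r` has no cluster point at all (`X_r` is closed)
  have hncl : ∀ a, ¬MapClusterPt a atTop u := by
    intro a ha
    obtain ⟨ψ, hψ, hlim⟩ := ha.tendsto_subseq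
    exact hno ⟨a, hclosed.mem_of_tendsto hlim (Eventually.of_forall fun n => hu (ψ n)),
      ψ, hψ, hlim⟩
  -- hence every point has a ball eventually avoided by `u`
  have hsep : ∀ a, ∃ ε : ℝ, 0 < ε ∧ ∃ N : ℕ, ∀ n, N ≤ n → ε ≤ dist (u n) a := by
    intro a
    have hna := hncl a
    rw [mapClusterPt_iff_frequently] at hna
    simp only [not_forall] at hna
    obtain ⟨s, hs, hns⟩ := hna
    obtain ⟨ε, hε, hball⟩ := Metric.mem_nhds_iff.mp hs
    obtain ⟨N, hN⟩ := eventually_atTop.mp (not_frequently.mp hns)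
    refine ⟨ε, hε, N, fun n hn => ?_⟩
    by_contra hlt
    exact hN n hn (hball (mem_ball.mpr (not_le.mp hlt)))
  choose ε hεpos N hN using hsep
  -- a separated subsequence `v = u ∘ ψ`: `dist (v k) (v j) ≥ ε (v j)` for `j < k`
  set M : ℕ → ℕ := fun n => (Finset.range (n + 1)).sup fun j => N (u j) with hM
  have hNM : ∀ j n, j ≤ n → N (u j) ≤ M n := fun j n hjn =>
    Finset.le_sup (f := fun j => N (u j)) (Finset.mem_range.mpr (Nat.lt_succ_of_le hjn))
  have hMmono : Monotone M := fun a b hab =>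
    Finset.sup_mono (Finset.range_mono (Nat.succ_le_succ hab))
  let ψ : ℕ → ℕ := fun k => Nat.rec 0 (fun _ p => p + 1 + M p) k
  have hψs : ∀ k, ψ (k + 1) = ψ k + 1 + M (ψ k) := fun k => rfl
  have hψmono : StrictMono ψ := strictMono_nat_of_lt_succ fun k => by rw [hψs]; omega
  have hψsep : ∀ j k, j < k → N (u (ψ j)) ≤ ψ k := by
    intro j k hjk
    obtain ⟨k', rfl⟩ : ∃ k', k = k' + 1 := ⟨k - 1, by omega⟩
    rw [hψs]
    have hjk' : ψ j ≤ ψ k' := hψmono.monotone (by omega)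
    calc N (u (ψ j)) ≤ M (ψ j) := hNM _ _ le_rfl
      _ ≤ M (ψ k') := hMmono hjk'
      _ ≤ ψ k' + 1 + M (ψ k') := by omega
  set v : ℕ → X := fun k => u (ψ k) with hv
  have hvS : ∀ k, φ (v k) ≤ r := fun k => hu (ψ k)
  have hvsep : ∀ j k, j < k → ε (v j) ≤ dist (v k) (v j) := fun j k hjk =>
    hN (v j) (ψ k) (hψsep j k hjk)
  -- radii: `η j = min_{i ≤ j} ε (v i)`, so distinct `v i`, `v j` are `≥ (η i + η j)/2` apart
  set η : ℕ → ℝ := fun j => (Finset.range (j + 1)).inf' ⟨0, by simp⟩ fun i => ε (v i) with hη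
  have hηpos : ∀ j, 0 < η j := fun j =>
    (Finset.lt_inf'_iff _).mpr fun i _ => hεpos (v i)
  have hηle : ∀ i j, i ≤ j → η j ≤ ε (v i) := fun i j hij =>
    Finset.inf'_le _ (Finset.mem_range.mpr (Nat.lt_succ_of_le hij))
  have hdist : ∀ i j, i ≠ j → η i + η j ≤ 2 * dist (v i) (v j) := by
    intro i j hij
    rcases lt_or_gt_of_ne hij with hlt | hlt
    · have hd := hvsep i j hlt
      rw [dist_comm] at hd
      linarith [hηle i i le_rfl, hηle i j hlt.le]
    · have hd := hvsep j i hlt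
      linarith [hηle j j le_rfl, hηle j i hlt.le]
  -- (6.5.2): `φ > φ (v j) - 1/(2(j+1))` on a ball around `v j` (lower semicontinuity)
  have hτ : ∀ j : ℕ, ∃ τ : ℝ, 0 < τ ∧ ∀ x, dist x (v j) < τ →
      φ (v j) - 1 / (2 * ((j : ℝ) + 1)) < φ x := by
    intro j
    have hpos : (0 : ℝ) < 1 / (2 * ((j : ℝ) + 1)) := by positivity
    obtain ⟨τ, hτ, hball⟩ := Metric.eventually_nhds_iff.mp
      ((lowerSemicontinuousAt_iff.mp (hlsc (v j))) (φ (v j) - 1 / (2 * ((j : ℝ) + 1)))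
        (by linarith))
    exact ⟨τ, hτ, fun x hx => hball hx⟩
  choose τ hτpos hτφ using hτ
  set ρ : ℕ → ℝ := fun j => min (η j / 2) (min (1 / ((j : ℝ) + 1)) (τ j)) with hρ
  have hρpos : ∀ j, 0 < ρ j := fun j =>
    lt_min (by linarith [hηpos j]) (lt_min (by positivity) (hτpos j))
  have hρη : ∀ j, ρ j ≤ η j / 2 := fun j => min_le_left _ _
  have hρj : ∀ j, ρ j ≤ 1 / ((j : ℝ) + 1) := fun j =>
    (min_le_right _ _).trans (min_le_left _ _)
  have hρτ : ∀ j, ρ j ≤ τ j := fun j => (min_le_right _ _).trans (min_le_right _ _)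
  -- the balls `B(v j, ρ j)` are pairwise disjoint
  have hdisj : ∀ x i j, dist x (v i) < ρ i → dist x (v j) < ρ j → i = j := by
    intro x i j hi hj
    by_contra hij
    have h1 := hdist i j hij
    have h2 := dist_triangle_left (v i) (v j) x
    linarith [hρη i, hρη j]
  -- tent functions `g j ≤ 0` supported in `B(v j, ρ j)` with `g j (v j) = -c j`
  set c : ℕ → ℝ := fun j => φ (v j) - m + 1 - 1 / ((j : ℝ) + 1) with hc
  have hc_nn : ∀ j, 0 ≤ c j := by
    intro j
    have h1 : m ≤ φ (v j) := ha₀ _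
    have h2 : 1 / ((j : ℝ) + 1) ≤ 1 := by
      rw [div_le_one (by positivity)]
      linarith [(Nat.cast_nonneg j : (0 : ℝ) ≤ j)]
    simp only [hc]
    linarith
  have hc_le : ∀ j, c j ≤ r - m + 1 := by
    intro j
    have h1 := hvS j
    have h2 : (0 : ℝ) ≤ 1 / ((j : ℝ) + 1) := by positivity
    simp only [hc]
    linarith
  set g : ℕ → X → ℝ := fun j x => -(c j * max 0 (1 - dist x (v j) / ρ j)) with hg
  have hg_cont : ∀ j, Continuous (g j) := fun j =>
    (continuous_const.mul (continuous_const.max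
      (continuous_const.sub ((continuous_id.dist continuous_const).div_const _)))).neg
  have hbump_le : ∀ j x, max 0 (1 - dist x (v j) / ρ j) ≤ 1 := fun j x =>
    max_le zero_le_one
      (sub_le_self _ (div_nonneg (dist_nonneg (x := x) (y := v j)) (hρpos j).le))
  have hg_zero : ∀ j x, ρ j ≤ dist x (v j) → g j x = 0 := by
    intro j x hx
    have h1 : 1 - dist x (v j) / ρ j ≤ 0 := by
      rw [sub_nonpos, le_div_iff₀ (hρpos j), one_mul]
      exact hx
    simp [hg, max_eq_left h1]
  have hg_ge : ∀ j x, -c j ≤ g j x := fun j x => by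
    simp only [hg, neg_le_neg_iff]
    exact mul_le_of_le_one_right (hc_nn j) (hbump_le j x)
  have hg_le : ∀ j x, g j x ≤ 0 := fun j x =>
    neg_nonpos.mpr (mul_nonneg (hc_nn j) (le_max_left _ _))
  have hg_self : ∀ j, g j (v j) = -c j := fun j => by simp [hg]
  have hsupp : ∀ j x, g j x ≠ 0 → dist x (v j) < ρ j := fun j x hx =>
    not_le.mp fun hle => hx (hg_zero j x hle)
  -- the family of supports is locally finite (here the separation of `v` is used)
  have hlf : LocallyFinite fun j => Function.support (g j) := by
    intro a
    obtain ⟨J, hJ⟩ := exists_nat_one_div_lt (half_pos (hεpos a))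
    refine ⟨ball a (ε a / 2), ball_mem_nhds a (half_pos (hεpos a)), ?_⟩
    refine (Set.finite_lt_nat (max (N a) J + 1)).subset ?_
    intro j hj
    obtain ⟨x, hxg, hxa⟩ := hj
    simp only [mem_setOf_eq]
    by_contra hjK
    have hjN : N a ≤ j := by omega
    have hjJ : J ≤ j := by omega
    have h1 : ε a ≤ dist (v j) a := hN a (ψ j) (hjN.trans (hψmono.id_le j))
    have h2 : dist x (v j) < ρ j := hsupp j x hxg
    have h3 : dist x a < ε a / 2 := mem_ball.mp hxa
    have h5 : 1 / ((j : ℝ) + 1) ≤ 1 / ((J : ℝ) + 1) := by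
      apply one_div_le_one_div_of_le (by positivity)
      exact_mod_cast Nat.succ_le_succ hjJ
    have h6 := dist_triangle (v j) x a
    rw [dist_comm x (v j)] at h2
    linarith [hρj j]
  -- `G := ∑ᶠ_j g j`, a bounded continuous function
  set G : X → ℝ := fun x => ∑ᶠ j, g j x with hG
  have hG_cont : Continuous G := continuous_finsum hg_cont hlf
  have hG_in : ∀ x j, dist x (v j) < ρ j → G x = g j x := by
    intro x j hj
    refine finsum_eq_single (fun i => g i x) j fun i hij => ?_
    by_contra hne
    exact hij (hdisj x i j (hsupp i x hne) hj)
  have hG_out : ∀ x, (∀ j, ρ j ≤ dist x (v j)) → G x = 0 := fun x hx =>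
    finsum_eq_zero_of_forall_eq_zero fun j => hg_zero j x (hx j)
  have hG_bounds : ∀ x, -(r - m + 1) ≤ G x ∧ G x ≤ 0 := by
    intro x
    by_cases hx : ∃ j, dist x (v j) < ρ j
    · obtain ⟨j, hj⟩ := hx
      rw [hG_in x j hj]
      exact ⟨by linarith [hg_ge j x, hc_le j], hg_le j x⟩
    · have hx' : ∀ j, ρ j ≤ dist x (v j) := fun j => not_lt.mp fun hlt => hx ⟨j, hlt⟩
      rw [hG_out x hx']
      exact ⟨by linarith, le_rfl⟩
  -- (6.5.3): `G x + φ x > m - 1` everywhere, while `G (v j) + φ (v j) = m - 1 + 1/(j+1)`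
  have hkey : ∀ x, m - 1 < G x + φ x := by
    intro x
    by_cases hx : ∃ j, dist x (v j) < ρ j
    · obtain ⟨j, hj⟩ := hx
      rw [hG_in x j hj]
      have h1 := hg_ge j x
      have h2 := hτφ j x (hj.trans_le (hρτ j))
      have h4 : 1 / (2 * ((j : ℝ) + 1)) = (1 / ((j : ℝ) + 1)) / 2 := by
        rw [div_div, mul_comm]
      have h5 : (0 : ℝ) ≤ 1 / ((j : ℝ) + 1) := by positivity
      simp only [hc] at h1
      linarith
    · have hx' : ∀ j, ρ j ≤ dist x (v j) := fun j => not_lt.mp fun hlt => hx ⟨j, hlt⟩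
      rw [hG_out x hx']
      linarith [ha₀ x]
  have hval : ∀ j, G (v j) + φ (v j) = m - 1 + 1 / ((j : ℝ) + 1) := by
    intro j
    rw [hG_in (v j) j (by simpa using hρpos j), hg_self]
    simp only [hc]
    ring
  obtain ⟨a, ha⟩ := h G hG_cont ⟨r - m + 1, fun x =>
    abs_le.mpr ⟨(hG_bounds x).1, (hG_bounds x).2.trans (by linarith)⟩⟩
  have hθ : 0 < G a + φ a - (m - 1) := by linarith [hkey a]
  obtain ⟨j, hj⟩ := exists_nat_one_div_lt hθ
  have hmin := ha (v j)
  rw [hval j] at hmin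
  linarith

/-- [cite: BorweinZhu2005, §6.5.1 Theorems 6.5.1 and 6.5.2 ("in a metric space the
conditions imposed on φ in Theorem 6.5.1 are also necessary"), pp. 281–282] On a nonempty
metric space, `φ : X → ℝ` is a one-perturbation function iff it is lsc with compact sublevel
sets. -/
theorem isOnePerturbation_iff [Nonempty X] :
    IsOnePerturbation φ ↔ LowerSemicontinuous φ ∧ ∀ r, IsCompact {x | φ x ≤ r} :=
  ⟨fun h => ⟨h.lowerSemicontinuous, h.isCompact_sublevel⟩,
    fun h => isOnePerturbation_of_isCompact_sublevel h.1 h.2⟩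

/-- [cite: BorweinZhu2005, §6.5.1 Theorem 6.5.2 (full conclusion: lsc, bounded from below,
compact sublevel sets), pp. 281–282] -/
theorem IsOnePerturbation.lsc_bddBelow_isCompact (h : IsOnePerturbation φ) :
    LowerSemicontinuous φ ∧ BddBelow (range φ) ∧ ∀ r, IsCompact {x | φ x ≤ r} :=
  ⟨h.lowerSemicontinuous, h.bddBelow, h.isCompact_sublevel⟩

end Converse

/-! ## Exercise 6.5.2: localisation in normed spaces -/

section Normed

variable {E : Type*} [NormedAddCommGroup E] [NormedSpace ℝ E]

/-- [cite: BorweinZhu2005, §6.5.4 Exercise 6.5.2 (localization of the minimum, cf. the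
Commentary), pp. 288–289] Let `φ` be as in Theorem 6.5.1 on a real normed space and `f` lsc
and bounded below.  For every `x̄` and `λ > 0` there is `μ > 0` such that
`f + φ (μ⁻¹ (· - x̄))` attains its minimum at some `u` with `‖u - x̄‖ ≤ λ`. -/
theorem exists_localized_minimizer {φ f : E → ℝ} (hφ : LowerSemicontinuous φ)
    (hφc : ∀ r, IsCompact {x | φ x ≤ r}) (hf : LowerSemicontinuous f)
    (hfb : ∃ m, ∀ x, m ≤ f x) (xbar : E) {lam : ℝ} (hlam : 0 < lam) :
    ∃ μ : ℝ, 0 < μ ∧ ∃ u : E,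
      (∀ y, f u + φ (μ⁻¹ • (u - xbar)) ≤ f y + φ (μ⁻¹ • (y - xbar))) ∧ ‖u - xbar‖ ≤ lam := by
  obtain ⟨m, hm⟩ := hfb
  -- a bound `R` for the compact sublevel set `{φ ≤ f x̄ - m + φ 0}`
  obtain ⟨R, hRpos, hR⟩ := (hφc (f xbar - m + φ 0)).isBounded.exists_pos_norm_le
  set μ : ℝ := lam / R with hμ
  have hμpos : 0 < μ := div_pos hlam hRpos
  refine ⟨μ, hμpos, ?_⟩
  -- the rescaled perturbation `φ_μ := φ (μ⁻¹ (· - x̄))` again satisfies Theorem 6.5.1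
  set φμ : E → ℝ := fun x => φ (μ⁻¹ • (x - xbar)) with hφμ
  have hcont : Continuous fun x : E => μ⁻¹ • (x - xbar) := by fun_prop
  have hφμ_lsc : LowerSemicontinuous φμ := hφ.comp hcont
  have hφμ_c : ∀ r, IsCompact {x | φμ x ≤ r} := by
    intro r
    have himg : IsCompact ((fun y : E => xbar + μ • y) '' {y | φ y ≤ r}) :=
      (hφc r).image (by fun_prop)
    refine himg.of_isClosed_subset (hφμ_lsc.isClosed_preimage r) fun x hx => ?_
    refine ⟨μ⁻¹ • (x - xbar), hx, ?_⟩
    simp only [smul_smul, mul_inv_cancel₀ hμpos.ne', one_smul, add_sub_cancel]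
  obtain ⟨u, hu⟩ := exists_forall_add_le (X := E) hφμ_lsc hφμ_c hf ⟨m, hm⟩
  refine ⟨u, hu, ?_⟩
  -- localisation: comparing with `y = x̄` puts `μ⁻¹ (u - x̄)` in the bounded sublevel set
  have h1 := hu xbar
  simp only [hφμ, sub_self, smul_zero] at h1
  have h2 : φ (μ⁻¹ • (u - xbar)) ≤ f xbar - m + φ 0 := by linarith [hm u]
  have h3 : ‖μ⁻¹ • (u - xbar)‖ ≤ R := hR _ h2
  rw [norm_smul, norm_inv, Real.norm_of_nonneg hμpos.le, inv_mul_le_iff₀ hμpos] at h3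
  calc ‖u - xbar‖ ≤ μ * R := h3
    _ = lam := by rw [hμ]; field_simp

end Normed

end Literature.Analysis.Convex.OnePerturbationVariationalPrinciple
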